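import Summits.CriticalPhenomena.PercolationContinuityZ3.Theorems.Transplant.FKConnectivityAllQAntipodalRootFormGeneral
import Summits.CriticalPhenomena.PercolationContinuityZ3.Theorems.Transplant.FKConnectivityAllQAntipodalAndPlus
import Summits.CriticalPhenomena.PercolationContinuityZ3.Theorems.Transplant.FKConnectivityAllQAntipodalMinorWeightUpc

/-!
# Connectivity correlation inequalities for `φ_{w,q}`, every `q > 0` — file 61Ω: **CONJECTURE `C_∞⁺` AT LEVEL 3 IS A THEOREM ON
# SERIES–PARALLEL GRAPHS: every increasing `f` reading three edges, every increasing `g` blind to them, every cell, every level**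

Support file (`--supports stmt-CriticalPhenomena-4575`), FK sub-lane `prim-bschramm-fk-2` (gen 29); builds on p205010 (kernel theorem,
internal audit signed; external expert review pending).  No definitions, no named facts, no sorries; standard axioms.  Memo
FROM-fk-2-g29-BRIDGE.md §5.

THE ODD CONE.  For a function `f` of the three bits `(ω_x, ω_y, ω_z)` the antipodal form only sees the odd part `F_f(σ) = f(σ) − f(σᶜ)`
(`σ ⊆ {x,y,z}`), a vector of `ℝ⁴` (values at `σ ∋ x`).  As `f` ranges over the INCREASING functions of three bits, `F_f` ranges over the cone
`K = {v : v_x ≤ v_xy ≤ v_xyz, v_x ≤ v_xz ≤ v_xyz, v_x + v_xyz ≥ 0, v_xy + v_xz ≥ 0}`, a cone over a triangular bipyramid whose FIVE extreme rays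
are the odd parts of the three dictators `ω_x, ω_y, ω_z`, of `AND₃ = ω_x ω_y ω_z` and of the majority `maj₃`; the eleven other increasing Boolean
types are midpoints (`x ∧ y = (x + y)/2`, `x(y ∨ z) = (x + maj₃)/2`, `y ∧ z = (y + z)/2`, duals coincide).  Explicitly (`odd3_decomp`), with
`v₁ = f{x} − f{y,z}`, `v₂ = f{x,y} − f{z}`, `v₃ = f{x,z} − f{y}`, `v₄ = f{x,y,z} − f∅` and `δ = v₁ + v₄ − v₂ − v₃`:
`F_f = ½(v₂+v₃)F_x + ½(v₂−v₁)F_y + ½(v₃−v₁)F_z + δ·F_{AND₃}` and `F_x + F_y + F_z = F_{maj₃} + 2F_{AND₃}` (`odd3_relation`); for increasing `f`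
all coefficients are `≥ 0` when `δ ≥ 0`, and after substituting the relation all are `≥ 0` when `δ ≤ 0`.
Hence (`apPsiC_levels_le_read3_nonpos_of_isTTSP`) the levelwise `q`-free inequality for EVERY increasing `f` of three edges follows from three
kernel theorems of this lineage: Theorem U levelwise (`FK.apPsiC_levels_le_pivot_nonpos_of_isTTSP`, gen 21), AND⁺
(`FK.apPsiC_levels_le_and_nonpos_of_isTTSP`, gen 21) and `maj₃⁺` (`FK.RootForm.maj3_levels_le_nonpos_of_isTTSP`, file 61z).
Also: the antipodal form has total mass `0` (`read3_total_eq_zero`, toggling the three specials), so the level form is equivalent to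
`Z_H(z,q)² Cov_{φ_{z,q}}(f, g) ∈ (q − 1)·ℝ≥0[z,q]` and implies the inequality against EVERY antitone level weight
(`apPsiCW_read3_nonpos_of_isTTSP`) and for every `0 ≤ q ≤ 1` (`apPsiC_read3_nonpos_of_isTTSP`).
[cite: Grimmett2006, §1.4 eq. (1.20) (p. 15); §3.8 Thm. (3.90) (pp. 61–62); §3.9 (pp. 63–64)] [cite: Wagner2006, Thm. 5.8(d), §5.3]
-/

noncomputable section

namespace Summit.CriticalPhenomena.PercolationContinuityZ3.Theorems

namespace FK

namespace RootForm

open SimpleGraph Finset Literature.Probability.LatticeModels Literature.Probability.Percolation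
open scoped Classical

variable {V : Type*} [Fintype V]

section OddCone

variable {M' C : Finset (Sym2 V)} {x y z : Sym2 V} {f : Finset (Sym2 V) → ℝ}

omit [Fintype V] in
/-- The eight values of a function reading only `x, y, z`, as a membership-conditional. [folklore] -/
theorem read3_eval (hxy : x ≠ y) (hxz : x ≠ z) (hyz : y ≠ z)
    (hf : ∀ A B : Finset (Sym2 V), (x ∈ A ↔ x ∈ B) → (y ∈ A ↔ y ∈ B) → (z ∈ A ↔ z ∈ B) → f A = f B) (A : Finset (Sym2 V)) :
    f A = if x ∈ A then (if y ∈ A then (if z ∈ A then f {x, y, z} else f {x, y}) else (if z ∈ A then f {x, z} else f {x}))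
      else (if y ∈ A then (if z ∈ A then f {y, z} else f {y}) else (if z ∈ A then f {z} else f ∅)) := by
  by_cases hx : x ∈ A <;> by_cases hy : y ∈ A <;> by_cases hz : z ∈ A <;> simp only [hx, hy, hz, if_true, if_false] <;>
    refine hf _ _ ?_ ?_ ?_ <;>
    simp [hx, hy, hz, hxy, hxz, hyz, hxy.symm, hxz.symm, hyz.symm]

omit [Fintype V] in
/-- **The odd-cone decomposition** of the antipodal integrand of a function `f` reading only `x, y, z` (any `f`, an identity):
`F_f = ½(v₂+v₃)·F_x + ½(v₂−v₁)·F_y + ½(v₃−v₁)·F_z + δ·F_{AND₃}` (module docstring). [folklore] -/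
theorem odd3_decomp (hxC : x ∉ C) (hyC : y ∉ C) (hzC : z ∉ C) (hxM : x ∈ M') (hyM : y ∈ M') (hzM : z ∈ M')
    (hxy : x ≠ y) (hxz : x ≠ z) (hyz : y ≠ z)
    (hf : ∀ A B : Finset (Sym2 V), (x ∈ A ↔ x ∈ B) → (y ∈ A ↔ y ∈ B) → (z ∈ A ↔ z ∈ B) → f A = f B) (γ : Finset (Sym2 V)) :
    f (γ ∪ C) - f (M' \ γ ∪ C) =
      (f {x, y} - f {z} + f {x, z} - f {y}) / 2 * ((if x ∈ γ then (1 : ℝ) else 0) - (if x ∈ M' \ γ then 1 else 0)) +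
      (f {x, y} - f {z} - f {x} + f {y, z}) / 2 * ((if y ∈ γ then (1 : ℝ) else 0) - (if y ∈ M' \ γ then 1 else 0)) +
      (f {x, z} - f {y} - f {x} + f {y, z}) / 2 * ((if z ∈ γ then (1 : ℝ) else 0) - (if z ∈ M' \ γ then 1 else 0)) +
      (f {x} - f {y, z} + f {x, y, z} - f ∅ - f {x, y} + f {z} - f {x, z} + f {y}) *
        ((if insert x {y, z} ⊆ γ ∪ C then (1 : ℝ) else 0) - (if insert x {y, z} ⊆ M' \ γ ∪ C then 1 else 0)) := by
  rw [read3_eval hxy hxz hyz hf (γ ∪ C), read3_eval hxy hxz hyz hf (M' \ γ ∪ C)]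
  have ex : x ∈ γ ∪ C ↔ x ∈ γ := by rw [Finset.mem_union, or_iff_left hxC]
  have ey : y ∈ γ ∪ C ↔ y ∈ γ := by rw [Finset.mem_union, or_iff_left hyC]
  have ez : z ∈ γ ∪ C ↔ z ∈ γ := by rw [Finset.mem_union, or_iff_left hzC]
  have ex' : x ∈ M' \ γ ∪ C ↔ x ∉ γ := by rw [Finset.mem_union, or_iff_left hxC, Finset.mem_sdiff, and_iff_right hxM]
  have ey' : y ∈ M' \ γ ∪ C ↔ y ∉ γ := by rw [Finset.mem_union, or_iff_left hyC, Finset.mem_sdiff, and_iff_right hyM]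
  have ez' : z ∈ M' \ γ ∪ C ↔ z ∉ γ := by rw [Finset.mem_union, or_iff_left hzC, Finset.mem_sdiff, and_iff_right hzM]
  have ex'' : x ∈ M' \ γ ↔ x ∉ γ := by rw [Finset.mem_sdiff, and_iff_right hxM]
  have ey'' : y ∈ M' \ γ ↔ y ∉ γ := by rw [Finset.mem_sdiff, and_iff_right hyM]
  have ez'' : z ∈ M' \ γ ↔ z ∉ γ := by rw [Finset.mem_sdiff, and_iff_right hzM]
  have es : ∀ X : Finset (Sym2 V), insert x {y, z} ⊆ X ↔ x ∈ X ∧ y ∈ X ∧ z ∈ X := fun X => by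
    simp only [Finset.insert_subset_iff, Finset.singleton_subset_iff]
  simp only [es, ex, ey, ez, ex', ey', ez', ex'', ey'', ez'']
  by_cases hx : x ∈ γ <;> by_cases hy : y ∈ γ <;> by_cases hz : z ∈ γ <;> simp [hx, hy, hz] <;> ring

omit [Fintype V] in
/-- **The one linear relation among the five extreme rays:** `F_x + F_y + F_z = F_{maj₃} + 2·F_{AND₃}` pointwise. [folklore] -/
theorem odd3_relation (hxC : x ∉ C) (hyC : y ∉ C) (hzC : z ∉ C) (hxM : x ∈ M') (hyM : y ∈ M') (hzM : z ∈ M')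
    (γ : Finset (Sym2 V)) :
    ((if x ∈ γ then (1 : ℝ) else 0) - (if x ∈ M' \ γ then 1 else 0)) +
      ((if y ∈ γ then (1 : ℝ) else 0) - (if y ∈ M' \ γ then 1 else 0)) +
      ((if z ∈ γ then (1 : ℝ) else 0) - (if z ∈ M' \ γ then 1 else 0)) =
      (((fun X : Finset (Sym2 V) => if (x ∈ X ∧ y ∈ X) ∨ (x ∈ X ∧ z ∈ X) ∨ (y ∈ X ∧ z ∈ X) then (1 : ℝ) else 0) (γ ∪ C)) -
        ((fun X : Finset (Sym2 V) => if (x ∈ X ∧ y ∈ X) ∨ (x ∈ X ∧ z ∈ X) ∨ (y ∈ X ∧ z ∈ X) then (1 : ℝ) else 0) (M' \ γ ∪ C))) +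
      2 * ((if insert x {y, z} ⊆ γ ∪ C then (1 : ℝ) else 0) - (if insert x {y, z} ⊆ M' \ γ ∪ C then 1 else 0)) := by
  have ex : x ∈ γ ∪ C ↔ x ∈ γ := by rw [Finset.mem_union, or_iff_left hxC]
  have ey : y ∈ γ ∪ C ↔ y ∈ γ := by rw [Finset.mem_union, or_iff_left hyC]
  have ez : z ∈ γ ∪ C ↔ z ∈ γ := by rw [Finset.mem_union, or_iff_left hzC]
  have ex' : x ∈ M' \ γ ∪ C ↔ x ∉ γ := by rw [Finset.mem_union, or_iff_left hxC, Finset.mem_sdiff, and_iff_right hxM]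
  have ey' : y ∈ M' \ γ ∪ C ↔ y ∉ γ := by rw [Finset.mem_union, or_iff_left hyC, Finset.mem_sdiff, and_iff_right hyM]
  have ez' : z ∈ M' \ γ ∪ C ↔ z ∉ γ := by rw [Finset.mem_union, or_iff_left hzC, Finset.mem_sdiff, and_iff_right hzM]
  have ex'' : x ∈ M' \ γ ↔ x ∉ γ := by rw [Finset.mem_sdiff, and_iff_right hxM]
  have ey'' : y ∈ M' \ γ ↔ y ∉ γ := by rw [Finset.mem_sdiff, and_iff_right hyM]
  have ez'' : z ∈ M' \ γ ↔ z ∉ γ := by rw [Finset.mem_sdiff, and_iff_right hzM]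
  have es : ∀ X : Finset (Sym2 V), insert x {y, z} ⊆ X ↔ x ∈ X ∧ y ∈ X ∧ z ∈ X := fun X => by
    simp only [Finset.insert_subset_iff, Finset.singleton_subset_iff]
  simp only [es, ex, ey, ez, ex', ey', ez', ex'', ey'', ez'']
  by_cases hx : x ∈ γ <;> by_cases hy : y ∈ γ <;> by_cases hz : z ∈ γ <;> simp [hx, hy, hz] <;> ring

omit [Fintype V] in
/-- A function blind to `x, y, z` (insert-form) is blind to every `U ⊆ {x, y, z}` (union-form). [folklore] -/
theorem blind3_union {g : Finset (Sym2 V) → ℝ} (hgx : ∀ A : Finset (Sym2 V), g (insert x A) = g A)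
    (hgy : ∀ A : Finset (Sym2 V), g (insert y A) = g A) (hgz : ∀ A : Finset (Sym2 V), g (insert z A) = g A)
    (A U : Finset (Sym2 V)) (hU : U ⊆ insert x {y, z}) : g (A ∪ U) = g A := by
  have h1 : g (insert x (insert y (insert z (A ∪ U)))) = g (A ∪ U) := by rw [hgx, hgy, hgz]
  have h2 : g (insert x (insert y (insert z A))) = g A := by rw [hgx, hgy, hgz]
  rw [← h1, ← h2]
  congr 1
  ext e
  simp only [Finset.mem_insert, Finset.mem_union]
  constructor
  · rintro (h | h | h | h | h)
    · exact Or.inl h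
    · exact Or.inr (Or.inl h)
    · exact Or.inr (Or.inr (Or.inl h))
    · exact Or.inr (Or.inr (Or.inr h))
    · have := hU h
      simp only [Finset.mem_insert, Finset.mem_singleton] at this
      rcases this with h' | h' | h'
      · exact Or.inl h'
      · exact Or.inr (Or.inl h')
      · exact Or.inr (Or.inr (Or.inl h'))
  · rintro (h | h | h | h)
    · exact Or.inl h
    · exact Or.inr (Or.inl h)
    · exact Or.inr (Or.inr (Or.inl h))
    · exact Or.inr (Or.inr (Or.inr (Or.inl h)))

omit [Fintype V] in
/-- Blindness to `x` passes to `A ↦ g (A ∪ C)`. [folklore] -/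
theorem blind_union_const {g : Finset (Sym2 V) → ℝ} (hgx : ∀ A : Finset (Sym2 V), g (insert x A) = g A) (A : Finset (Sym2 V)) :
    g (insert x A ∪ C) = g (A ∪ C) := by
  rw [Finset.insert_union, hgx]

end OddCone

section Main

variable {E M C : Finset (Sym2 V)} {a b uy vy uz vz : V}

/-- **CONJECTURE `C_∞⁺` AT LEVEL 3 ON SERIES–PARALLEL GRAPHS (levelwise form).**  `𝓔` two-terminal series–parallel between `a, b`,
`x = ab ∉ 𝓔` (so `H = 𝓔 ∪ x` is any 2-connected series–parallel graph presented from an edge), `y ≠ z ∈ 𝓔` two further special edges, a cell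
`M` (free) / `C` (contracted) inside `𝓔 \ {y,z}` (disjoint); `f` ANY increasing function reading only `x, y, z` (real-valued), `g` any increasing
function blind to `x, y, z`.  Then for every level `J`:
`Σ_{γ ⊆ M ∪ {x,y,z} : k(γ∪C)+k(γᶜ∪C) ≤ J} (f(γ∪C) − f(γᶜ∪C))·(g(γ∪C) − g(γᶜ∪C)) ≤ 0`.
Proof: the odd-cone decomposition reduces `f` to the five extreme types — dictators (Theorem U levelwise, `FK.apPsiC_levels_le_pivot_nonpos_of_isTTSP`),
`AND₃` (`FK.apPsiC_levels_le_and_nonpos_of_isTTSP`) and `maj₃` (`maj3_levels_le_nonpos_of_isTTSP`) — with nonnegative coefficients.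
[cite: Grimmett2006, §1.4 eq. (1.20) (p. 15); §3.8 Thm. (3.90) (pp. 61–62); §3.9 (pp. 63–64)] [cite: Wagner2006, Thm. 5.8(d), §5.3] -/
theorem apPsiC_levels_le_read3_nonpos_of_isTTSP (hE : IsTTSP E a b) (hx : s(a, b) ∉ E) (hy : s(uy, vy) ∈ E) (hz : s(uz, vz) ∈ E)
    (hyz : s(uy, vy) ≠ s(uz, vz)) (hM : M ⊆ (E.erase s(uy, vy)).erase s(uz, vz)) (hC : C ⊆ (E.erase s(uy, vy)).erase s(uz, vz))
    (hMC : Disjoint M C)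
    {f : Finset (Sym2 V) → ℝ}
    (hf : ∀ A B : Finset (Sym2 V), (s(a, b) ∈ A ↔ s(a, b) ∈ B) → (s(uy, vy) ∈ A ↔ s(uy, vy) ∈ B) →
      (s(uz, vz) ∈ A ↔ s(uz, vz) ∈ B) → f A = f B)
    (hfm : ∀ ⦃X Y : Finset (Sym2 V)⦄, X ⊆ Y → f X ≤ f Y)
    {g : Finset (Sym2 V) → ℝ} (hgx : ∀ A : Finset (Sym2 V), g (insert s(a, b) A) = g A)
    (hgy : ∀ A : Finset (Sym2 V), g (insert s(uy, vy) A) = g A) (hgz : ∀ A : Finset (Sym2 V), g (insert s(uz, vz) A) = g A)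
    (hmono : ∀ ⦃X Y : Finset (Sym2 V)⦄, X ⊆ Y → g X ≤ g Y) (J : ℕ) :
    ∑ γ ∈ (insert s(a, b) (insert s(uy, vy) (insert s(uz, vz) M))).powerset with
        apExpC (insert s(a, b) (insert s(uy, vy) (insert s(uz, vz) M))) C γ ≤ J,
        (f (γ ∪ C) - f ((insert s(a, b) (insert s(uy, vy) (insert s(uz, vz) M))) \ γ ∪ C)) *
          (g (γ ∪ C) - g ((insert s(a, b) (insert s(uy, vy) (insert s(uz, vz) M))) \ γ ∪ C)) ≤ 0 := by
  -- names
  set x : Sym2 V := s(a, b) with hxdef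
  set y : Sym2 V := s(uy, vy) with hydef
  set z : Sym2 V := s(uz, vz) with hzdef
  set M' : Finset (Sym2 V) := insert x (insert y (insert z M)) with hM'def
  have hMe : M ⊆ E := hM.trans ((Finset.erase_subset _ _).trans (Finset.erase_subset _ _))
  have hCe : C ⊆ E := hC.trans ((Finset.erase_subset _ _).trans (Finset.erase_subset _ _))
  have hyM : y ∉ M := fun h => (Finset.mem_erase.1 (Finset.mem_of_mem_erase (hM h))).1 rfl
  have hzM : z ∉ M := fun h => (Finset.mem_erase.1 (hM h)).1 rfl
  have hyC : y ∉ C := fun h => (Finset.mem_erase.1 (Finset.mem_of_mem_erase (hC h))).1 rfl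
  have hzC : z ∉ C := fun h => (Finset.mem_erase.1 (hC h)).1 rfl
  have hxM : x ∉ M := fun h => hx (hMe h)
  have hxC : x ∉ C := fun h => hx (hCe h)
  have hxy : x ≠ y := fun h => hx (h ▸ hy)
  have hxz : x ≠ z := fun h => hx (h ▸ hz)
  have hxM' : x ∈ M' := Finset.mem_insert_self _ _
  have hyM' : y ∈ M' := Finset.mem_insert_of_mem (Finset.mem_insert_self _ _)
  have hzM' : z ∈ M' := Finset.mem_insert_of_mem (Finset.mem_insert_of_mem (Finset.mem_insert_self _ _))
  have hM'E : M' ⊆ insert x E :=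
    Finset.insert_subset_insert _ (Finset.insert_subset hy (Finset.insert_subset hz hMe))
  have hCE : C ⊆ insert x E := hCe.trans (Finset.subset_insert _ _)
  have hM'C : Disjoint M' C := by
    rw [hM'def, Finset.disjoint_insert_left, Finset.disjoint_insert_left, Finset.disjoint_insert_left]
    exact ⟨hxC, hyC, hzC, hMC⟩
  -- the three dictators (Theorem U levelwise at `x`, `y`, `z`, with `g ↦ g(· ∪ C)`)
  have hgC : ∀ e ∈ C, ∀ A : Finset (Sym2 V), (fun A => g (A ∪ C)) (insert e A) = (fun A => g (A ∪ C)) A := by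
    intro e he A
    show g (insert e A ∪ C) = g (A ∪ C)
    rw [Finset.insert_union, Finset.insert_eq_of_mem (Finset.mem_union_right _ he)]
  have hmono' : ∀ ⦃A B : Finset (Sym2 V)⦄, A ⊆ B → B ⊆ M' → (fun A => g (A ∪ C)) A ≤ (fun A => g (A ∪ C)) B :=
    fun A B hAB _ => hmono (Finset.union_subset_union hAB le_rfl)
  have hCC : ∀ A : Finset (Sym2 V), A ∪ C ∪ C = A ∪ C := fun A => by rw [Finset.union_assoc, Finset.union_idempotent]
  have Sx := apPsiC_levels_le_pivot_nonpos_of_isTTSP hE hx hM'E hCE hM'C hxM' J (g := fun A => g (A ∪ C))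
    (fun A => blind_union_const hgx A) hgC hmono'
  have Sy := apPsiC_levels_le_pivot_nonpos_of_isTTSP hE hx hM'E hCE hM'C hyM' J (g := fun A => g (A ∪ C))
    (fun A => blind_union_const hgy A) hgC hmono'
  have Sz := apPsiC_levels_le_pivot_nonpos_of_isTTSP hE hx hM'E hCE hM'C hzM' J (g := fun A => g (A ∪ C))
    (fun A => blind_union_const hgz A) hgC hmono'
  simp only [hCC] at Sx Sy Sz
  -- AND₃
  have hT : ({y, z} : Finset (Sym2 V)) ⊆ E := Finset.insert_subset hy (Finset.singleton_subset_iff.2 hz)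
  have hMT : Disjoint M ({y, z} : Finset (Sym2 V)) := by
    rw [Finset.disjoint_insert_right, Finset.disjoint_singleton_right]; exact ⟨hyM, hzM⟩
  have hTC : Disjoint ({y, z} : Finset (Sym2 V)) C := by
    rw [Finset.disjoint_insert_left, Finset.disjoint_singleton_left]; exact ⟨hyC, hzC⟩
  have hH : M ∪ insert x {y, z} = M' := by
    ext e
    simp only [hM'def, Finset.mem_union, Finset.mem_insert, Finset.mem_singleton]
    tauto
  have St := apPsiC_levels_le_and_nonpos_of_isTTSP hE hx hMe hT hCe hMT hMC hTC J (blind3_union hgx hgy hgz) hmono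
  rw [hH] at St
  -- maj₃
  have Sm := maj3_levels_le_nonpos_of_isTTSP hE hx hy hz hyz hM hC hMC hgx hgy hgz hmono J
  -- the decomposition of the sum
  have dec := fun γ => odd3_decomp (f := f) hxC hyC hzC hxM' hyM' hzM' hxy hxz hyz hf γ
  have rel := fun γ => odd3_relation (x := x) (y := y) (z := z) hxC hyC hzC hxM' hyM' hzM' γ
  have hsum : ∑ γ ∈ M'.powerset with apExpC M' C γ ≤ J, (f (γ ∪ C) - f (M' \ γ ∪ C)) * (g (γ ∪ C) - g (M' \ γ ∪ C)) =
      (f {x, y} - f {z} + f {x, z} - f {y}) / 2 *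
          ∑ γ ∈ M'.powerset with apExpC M' C γ ≤ J,
            ((if x ∈ γ then (1 : ℝ) else 0) - (if x ∈ M' \ γ then 1 else 0)) * (g (γ ∪ C) - g (M' \ γ ∪ C)) +
        (f {x, y} - f {z} - f {x} + f {y, z}) / 2 *
          ∑ γ ∈ M'.powerset with apExpC M' C γ ≤ J,
            ((if y ∈ γ then (1 : ℝ) else 0) - (if y ∈ M' \ γ then 1 else 0)) * (g (γ ∪ C) - g (M' \ γ ∪ C)) +
        (f {x, z} - f {y} - f {x} + f {y, z}) / 2 *
          ∑ γ ∈ M'.powerset with apExpC M' C γ ≤ J,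
            ((if z ∈ γ then (1 : ℝ) else 0) - (if z ∈ M' \ γ then 1 else 0)) * (g (γ ∪ C) - g (M' \ γ ∪ C)) +
        (f {x} - f {y, z} + f {x, y, z} - f ∅ - f {x, y} + f {z} - f {x, z} + f {y}) *
          ∑ γ ∈ M'.powerset with apExpC M' C γ ≤ J,
            ((if insert x {y, z} ⊆ γ ∪ C then (1 : ℝ) else 0) - (if insert x {y, z} ⊆ M' \ γ ∪ C then 1 else 0)) *
              (g (γ ∪ C) - g (M' \ γ ∪ C)) := by
    rw [Finset.mul_sum, Finset.mul_sum, Finset.mul_sum, Finset.mul_sum, ← Finset.sum_add_distrib, ← Finset.sum_add_distrib,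
      ← Finset.sum_add_distrib]
    refine Finset.sum_congr rfl fun γ _ => ?_
    rw [dec γ]
    ring
  have hrel : ∑ γ ∈ M'.powerset with apExpC M' C γ ≤ J,
        ((if x ∈ γ then (1 : ℝ) else 0) - (if x ∈ M' \ γ then 1 else 0)) * (g (γ ∪ C) - g (M' \ γ ∪ C)) +
      ∑ γ ∈ M'.powerset with apExpC M' C γ ≤ J,
        ((if y ∈ γ then (1 : ℝ) else 0) - (if y ∈ M' \ γ then 1 else 0)) * (g (γ ∪ C) - g (M' \ γ ∪ C)) +
      ∑ γ ∈ M'.powerset with apExpC M' C γ ≤ J,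
        ((if z ∈ γ then (1 : ℝ) else 0) - (if z ∈ M' \ γ then 1 else 0)) * (g (γ ∪ C) - g (M' \ γ ∪ C)) =
      ∑ γ ∈ M'.powerset with apExpC M' C γ ≤ J,
        (((fun X : Finset (Sym2 V) => if (x ∈ X ∧ y ∈ X) ∨ (x ∈ X ∧ z ∈ X) ∨ (y ∈ X ∧ z ∈ X) then (1 : ℝ) else 0) (γ ∪ C)) -
            ((fun X : Finset (Sym2 V) => if (x ∈ X ∧ y ∈ X) ∨ (x ∈ X ∧ z ∈ X) ∨ (y ∈ X ∧ z ∈ X) then (1 : ℝ) else 0)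
              (M' \ γ ∪ C))) * (g (γ ∪ C) - g (M' \ γ ∪ C)) +
      2 * ∑ γ ∈ M'.powerset with apExpC M' C γ ≤ J,
        ((if insert x {y, z} ⊆ γ ∪ C then (1 : ℝ) else 0) - (if insert x {y, z} ⊆ M' \ γ ∪ C then 1 else 0)) *
          (g (γ ∪ C) - g (M' \ γ ∪ C)) := by
    rw [Finset.mul_sum, ← Finset.sum_add_distrib, ← Finset.sum_add_distrib, ← Finset.sum_add_distrib]
    refine Finset.sum_congr rfl fun γ _ => ?_
    linear_combination (g (γ ∪ C) - g (M' \ γ ∪ C)) * rel γ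
  rw [hsum]
  -- the twelve cube-edge inequalities of `f`
  have m1 : f ∅ ≤ f {x} := hfm (Finset.empty_subset _)
  have m2 : f ∅ ≤ f {y} := hfm (Finset.empty_subset _)
  have m3 : f ∅ ≤ f {z} := hfm (Finset.empty_subset _)
  have m4 : f {x} ≤ f {x, y} := hfm (Finset.singleton_subset_iff.2 (Finset.mem_insert_self _ _))
  have m5 : f {x} ≤ f {x, z} := hfm (Finset.singleton_subset_iff.2 (Finset.mem_insert_self _ _))
  have m6 : f {y} ≤ f {x, y} := hfm (Finset.subset_insert _ _)
  have m7 : f {y} ≤ f {y, z} := hfm (Finset.singleton_subset_iff.2 (Finset.mem_insert_self _ _))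
  have m8 : f {z} ≤ f {x, z} := hfm (Finset.subset_insert _ _)
  have m9 : f {z} ≤ f {y, z} := hfm (Finset.subset_insert _ _)
  have m10 : f {x, y} ≤ f {x, y, z} := hfm (Finset.insert_subset_insert _ (Finset.singleton_subset_iff.2 (Finset.mem_insert_self _ _)))
  have m11 : f {x, z} ≤ f {x, y, z} := hfm (Finset.insert_subset_insert _ (Finset.subset_insert _ _))
  have m12 : f {y, z} ≤ f {x, y, z} := hfm (Finset.subset_insert _ _)
  -- chambers of the bipyramid
  by_cases hδ : 0 ≤ f {x} - f {y, z} + f {x, y, z} - f ∅ - f {x, y} + f {z} - f {x, z} + f {y}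
  · have t1 := mul_nonpos_of_nonneg_of_nonpos (show 0 ≤ (f {x, y} - f {z} + f {x, z} - f {y}) / 2 by linarith) Sx
    have t2 := mul_nonpos_of_nonneg_of_nonpos (show 0 ≤ (f {x, y} - f {z} - f {x} + f {y, z}) / 2 by linarith) Sy
    have t3 := mul_nonpos_of_nonneg_of_nonpos (show 0 ≤ (f {x, z} - f {y} - f {x} + f {y, z}) / 2 by linarith) Sz
    have t4 := mul_nonpos_of_nonneg_of_nonpos hδ St
    linear_combination t1 + t2 + t3 + t4
  · push Not at hδ
    have t1 := mul_nonpos_of_nonneg_of_nonpos (show 0 ≤ (f {x} - f {y, z} + f {x, y, z} - f ∅) / 2 by linarith) Sx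
    have t2 := mul_nonpos_of_nonneg_of_nonpos (show 0 ≤ (f {x, y, z} - f ∅ - f {x, z} + f {y}) / 2 by linarith) Sy
    have t3 := mul_nonpos_of_nonneg_of_nonpos (show 0 ≤ (f {x, y, z} - f ∅ - f {x, y} + f {z}) / 2 by linarith) Sz
    have t4 := mul_nonpos_of_nonneg_of_nonpos
      (show 0 ≤ -(f {x} - f {y, z} + f {x, y, z} - f ∅ - f {x, y} + f {z} - f {x, z} + f {y}) / 2 by linarith) Sm
    linear_combination t1 + t2 + t3 + t4 +
      (-(f {x} - f {y, z} + f {x, y, z} - f ∅ - f {x, y} + f {z} - f {x, z} + f {y}) / 2) * hrel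

/-- **COROLLARY (`C_∞` at level 3 for every `0 ≤ q ≤ 1`):** in the setting of `apPsiC_levels_le_read3_nonpos_of_isTTSP`,
`apPsiC q (M ∪ {x,y,z}) C f g ≤ 0` — the antipodal form of `Cov_{φ_{p,q}}(f, g)` for every random-cluster measure with `q ≤ 1` on the
2-connected series–parallel graph `H = 𝓔 ∪ x`, every increasing `f` reading three edges and every increasing `g` blind to them (Abel bridge).
[cite: Grimmett2006, §3.8 Thm. (3.90) (pp. 61–62); §3.9 (pp. 63–64)] [cite: Wagner2006, Thm. 5.8(d), §5.3] -/
theorem apPsiC_read3_nonpos_of_isTTSP {q : ℝ} (hq0 : 0 ≤ q) (hq1 : q ≤ 1) (hE : IsTTSP E a b) (hx : s(a, b) ∉ E)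
    (hy : s(uy, vy) ∈ E) (hz : s(uz, vz) ∈ E)
    (hyz : s(uy, vy) ≠ s(uz, vz)) (hM : M ⊆ (E.erase s(uy, vy)).erase s(uz, vz)) (hC : C ⊆ (E.erase s(uy, vy)).erase s(uz, vz))
    (hMC : Disjoint M C)
    {f : Finset (Sym2 V) → ℝ}
    (hf : ∀ A B : Finset (Sym2 V), (s(a, b) ∈ A ↔ s(a, b) ∈ B) → (s(uy, vy) ∈ A ↔ s(uy, vy) ∈ B) →
      (s(uz, vz) ∈ A ↔ s(uz, vz) ∈ B) → f A = f B)
    (hfm : ∀ ⦃X Y : Finset (Sym2 V)⦄, X ⊆ Y → f X ≤ f Y)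
    {g : Finset (Sym2 V) → ℝ} (hgx : ∀ A : Finset (Sym2 V), g (insert s(a, b) A) = g A)
    (hgy : ∀ A : Finset (Sym2 V), g (insert s(uy, vy) A) = g A) (hgz : ∀ A : Finset (Sym2 V), g (insert s(uz, vz) A) = g A)
    (hmono : ∀ ⦃X Y : Finset (Sym2 V)⦄, X ⊆ Y → g X ≤ g Y) :
    apPsiC q (insert s(a, b) (insert s(uy, vy) (insert s(uz, vz) M))) C f g ≤ 0 :=
  sum_pow_mul_nonpos_of_levels_le (insert s(a, b) (insert s(uy, vy) (insert s(uz, vz) M))).powerset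
    (apExpC (insert s(a, b) (insert s(uy, vy) (insert s(uz, vz) M))) C)
    (fun γ => (f (γ ∪ C) - f ((insert s(a, b) (insert s(uy, vy) (insert s(uz, vz) M))) \ γ ∪ C)) *
      (g (γ ∪ C) - g ((insert s(a, b) (insert s(uy, vy) (insert s(uz, vz) M))) \ γ ∪ C)))
    hq0 hq1 fun J => apPsiC_levels_le_read3_nonpos_of_isTTSP hE hx hy hz hyz hM hC hMC hf hfm hgx hgy hgz hmono J


end Main

end RootForm

end FK

end Summit.CriticalPhenomena.PercolationContinuityZ3.Theorems

end
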